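import Summits.QuantumAdvantage.QuantumAdvantage.Theorems.SosSandwichQueryAAQTwoQueries
import Summits.QuantumAdvantage.QuantumAdvantage.Theorems.SosSandwichPseudoBoundedAALevelKRung
import HarnessLib

/-!
# Route `SosSandwich`, crux `PseudoBoundedAA` (stmt-QuantumAdvantage-15237): `AA_Q` IS ITS MIDDLE-BAND CASE

The live analytic crux of the route is `AA_Q` (the hypothesis of `QueryRestrict.quantumQuerySimulable_of_aaQuery`,
`QueryPathBridge.pathBound_of_aaQuery_of_bridge`): every `T ≥ 1`-query acceptance polynomial with `Var ≥ ε > 0` has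
a variable with `C (ε/T)^c ≤ Inf_i`.  With the rungs now in the tree — level `1`, level `2` (`…LevelOneRung`,
`…LevelTwoRung`), the top two levels `2T-1, 2T` (`QueryTopLevel.twoTopLevels_rung_robust`), hence `T ≤ 2`
outright (`aaQuery_of_queries_le_two`) — the crux is EQUIVALENT to its restriction to the MIDDLE BAND:

* `MiddleBandAAQ c C` (inline, no new definition: the hypothesis of `aaQuery_of_middleBand`) — `AA_Q` asserted
  ONLY for algorithms with `T ≥ 3` queries whose acceptance polynomial has at least HALF of its variance on the
  Fourier levels `3 … 2T-2`;
* `aaQuery_of_middleBand` — **middle-band `AA_Q` ⟹ `AA_Q`** (with `(c', C') = (max c 6, min C (1/9216))`):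
  for `T ≤ 2` by `aaQuery_of_queries_le_two`; for `T ≥ 3`, either the middle band carries half the variance
  (hypothesis), or the extreme levels `1, 2, 2T-1, 2T` do and `aaQuery_of_extremeLevels_share` (`η = 1/2`)
  gives `Var² ≤ 2304·T⁶·maxInf`;
* `middleBand_of_aaQuery` — the converse is trivial (restriction), so the two are EQUIVALENT
  (`aaQuery_iff_middleBand`).

So the open content of `AA_Q` (= even-degree case of Escudero Gutiérrez 2023, Conj. 1.5) is exactly: influences
of bounded quantum acceptance polynomials whose Fourier weight sits in the middle band `3 … 2T-2` — where the
level-`k` rung (`LevelKRung.exists_influence_ge_levelK`) costs `3^k·T^{O(k)}`.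

Honest label: a reduction/equivalence (planner-facing: a candidate re-pointing of the crux); no stub, crux or summit
is proved.  Sources: Aaronson–Ambainis 2014 Conj. 6; Escudero Gutiérrez arXiv:2304.06713 Thm. 1.4 / Conj. 1.5;
O'Donnell 2014 §1.4.
-/

-- D-0017: single-conjunct summit ⇒ the duplicate `QuantumAdvantage.QuantumAdvantage` is mandated.
set_option linter.dupNamespace false

noncomputable section

namespace Summit.QuantumAdvantage.QuantumAdvantage.Theorems.SosSandwich.LevelTwoRung

open Finset
open Literature.Computability.QuantumComplexity
open Literature.Computability.Complexity.LowDegree (cubeFourierCoeff)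
open Literature.Computability.Cryptography (QQueryAlg)
open Summit.QuantumAdvantage.QuantumAdvantage.Theorems.SosSandwich.LevelOneRung
open Summit.QuantumAdvantage.QuantumAdvantage.Theorems.SosSandwich.LevelKRung
  (boolVariance_le_sum_levels boolVariance_eq_sum_nonempty)

variable {N : ℕ}

/-! ### The level decomposition around the middle band -/

/-- For `T ≥ 3` the levels `1 … 2T` are the extreme levels `1, 2, 2T-1, 2T` plus the middle band `3 … 2T-2`:
`Σ_{k=1}^{2T} W_k = W₁ + W₂ + W_{2T} + W_{2T-1} + Σ_{k=3}^{2T-2} W_k`. [folklore] -/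
theorem sum_Icc_levels_split {T : ℕ} (hT : 3 ≤ T) (W : ℕ → ℝ) :
    ∑ k ∈ Finset.Icc 1 (2 * T), W k =
      W 1 + W 2 + (W (2 * T) + W (2 * T - 1)) + ∑ k ∈ Finset.Icc 3 (2 * T - 2), W k := by
  classical
  rw [← Finset.sum_filter_add_sum_filter_not (Finset.Icc 1 (2 * T)) (fun k => k ∈ Finset.Icc 3 (2 * T - 2))]
  have hmid : (Finset.Icc 1 (2 * T)).filter (fun k => k ∈ Finset.Icc 3 (2 * T - 2)) = Finset.Icc 3 (2 * T - 2) := by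
    ext k
    simp only [Finset.mem_filter, Finset.mem_Icc]
    omega
  have hext : (Finset.Icc 1 (2 * T)).filter (fun k => ¬ k ∈ Finset.Icc 3 (2 * T - 2)) =
      ({1, 2, 2 * T, 2 * T - 1} : Finset ℕ) := by
    ext k
    simp only [Finset.mem_filter, Finset.mem_Icc, Finset.mem_insert, Finset.mem_singleton]
    omega
  rw [hmid, hext, add_comm]
  have h12 : (1 : ℕ) ∉ ({2, 2 * T, 2 * T - 1} : Finset ℕ) := by
    simp only [Finset.mem_insert, Finset.mem_singleton]; omega
  have h2 : (2 : ℕ) ∉ ({2 * T, 2 * T - 1} : Finset ℕ) := by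
    simp only [Finset.mem_insert, Finset.mem_singleton]; omega
  have h3 : (2 * T : ℕ) ∉ ({2 * T - 1} : Finset ℕ) := by
    simp only [Finset.mem_singleton]; omega
  rw [Finset.sum_insert h12, Finset.sum_insert h2, Finset.sum_insert h3, Finset.sum_singleton]
  ring

/-- The variance of a bounded cube function is at most `1` (`Var = Σ_{S≠∅} p̂(S)² ≤ Σ_S p̂(S)² = E p² ≤ 1`).
[cite: ODonnell2014, §1.4 (Parseval)] -/
theorem boolVariance_le_one {p : MvPolynomial (Fin N) ℝ} (hb : ∀ x, 0 ≤ evalBool p x ∧ evalBool p x ≤ 1) :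
    boolVariance p ≤ 1 := by
  classical
  rw [boolVariance_eq_sum_nonempty]
  exact (Finset.sum_le_sum_of_subset_of_nonneg (Finset.filter_subset _ _) fun S _ _ => sq_nonneg _).trans
    (sum_sq_fourier_le_one hb)

/-! ### Middle-band `AA_Q` implies `AA_Q` -/

/-- **Middle-band `AA_Q` ⟹ `AA_Q`.**  HYPOTHESIS (middle-band `AA_Q` with constants `c, C`): for every quantum
algorithm with `T ≥ 3` queries, every real polynomial `p` with its acceptance probabilities as cube values and
`Var[p] ≥ ε > 0`, IF at least half of the variance sits on the middle Fourier levels `3 … 2T-2` then some variable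
has `C (ε/T)^c ≤ Inf_i[p]`.  CONCLUSION: `AA_Q` (the hypothesis shape of `QueryRestrict.quantumQuerySimulable_of_aaQuery`)
with `(c', C') = (max c 6, min C (1/9216))`.  Cases: `T ≤ 2` by `aaQuery_of_queries_le_two`; `T ≥ 3` and the
extreme levels `1, 2, 2T-1, 2T` carry half the variance by `aaQuery_of_extremeLevels_share`; else the hypothesis.
[cite: AaronsonAmbainis2014, Conj. 6] [cite: ODonnell2014, §1.4] -/
theorem aaQuery_of_middleBand
    (hMB : ∃ (c : ℕ) (C : ℝ), 0 < C ∧ ∀ (N : ℕ) (Q : QQueryAlg N) (p : MvPolynomial (Fin N) ℝ) (ε : ℝ),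
      3 ≤ Q.queries → (∀ x, evalBool p x = Q.acceptProb x) → 0 < ε → ε ≤ boolVariance p →
      boolVariance p ≤ 2 * ∑ k ∈ Finset.Icc 3 (2 * Q.queries - 2),
        ∑ S ∈ univ.filter (fun S : Finset (Fin N) => S.card = k), cubeFourierCoeff (evalBool p) S ^ 2 →
        ∃ i : Fin N, C * (ε / Q.queries) ^ c ≤ influence i p) :
    ∃ (c : ℕ) (C : ℝ), 0 < C ∧ ∀ (N : ℕ) (Q : QQueryAlg N) (p : MvPolynomial (Fin N) ℝ) (ε : ℝ),
      1 ≤ Q.queries → (∀ x, evalBool p x = Q.acceptProb x) → 0 < ε → ε ≤ boolVariance p →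
        ∃ i : Fin N, C * (ε / Q.queries) ^ c ≤ influence i p := by
  classical
  obtain ⟨c, C, hC, H⟩ := hMB
  obtain ⟨c₂, C₂, hC₂, H₂⟩ := (aaQuery_of_queries_le_two : ∃ (c : ℕ) (C : ℝ), 0 < C ∧
    ∀ (N : ℕ) (Q : QQueryAlg N) (p : MvPolynomial (Fin N) ℝ) (ε : ℝ),
      Q.queries ≤ 2 → 1 ≤ Q.queries → (∀ x, evalBool p x = Q.acceptProb x) → 0 < ε → ε ≤ boolVariance p →
        ∃ i : Fin N, C * (ε / Q.queries) ^ c ≤ influence i p)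
  -- common exponent `c* = max (max c c₂) 6` and constant `C* = min (min C C₂) (1/2304)`
  refine ⟨max (max c c₂) 6, min (min C C₂) (1 / 2304), by positivity, fun N Q p ε hT hp hε hv => ?_⟩
  set c' := max (max c c₂) 6 with hc'
  set C' := min (min C C₂) (1 / 2304 : ℝ) with hC'
  have hC'pos : 0 < C' := by positivity
  have hTpos : (0 : ℝ) < Q.queries := by exact_mod_cast hT
  have hb : ∀ x, 0 ≤ evalBool p x ∧ evalBool p x ≤ 1 := fun x => acceptPoly_bounded Q p hp x
  have hv1 : boolVariance p ≤ 1 := boolVariance_le_one hb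
  have hx1 : ε / Q.queries ≤ 1 := by
    rw [div_le_one hTpos]
    have : (1 : ℝ) ≤ Q.queries := by exact_mod_cast hT
    linarith [hv.trans hv1]
  have hx0 : 0 ≤ ε / Q.queries := by positivity
  -- a bound `C₀ (ε/T)^{c₀} ≤ Inf` with `C' ≤ C₀`, `c₀ ≤ c'` gives `C' (ε/T)^{c'} ≤ Inf`
  have mono : ∀ {C₀ : ℝ} {c₀ : ℕ} {I : ℝ}, C' ≤ C₀ → c₀ ≤ c' → C₀ * (ε / Q.queries) ^ c₀ ≤ I →
      C' * (ε / Q.queries) ^ c' ≤ I := by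
    intro C₀ c₀ I hCC hcc hI
    have hpow : (ε / Q.queries) ^ c' ≤ (ε / Q.queries) ^ c₀ := pow_le_pow_of_le_one hx0 hx1 hcc
    calc C' * (ε / Q.queries) ^ c' ≤ C₀ * (ε / Q.queries) ^ c₀ :=
          mul_le_mul hCC hpow (by positivity) (hC'pos.le.trans hCC)
      _ ≤ I := hI
  rcases Nat.lt_or_ge Q.queries 3 with hT2 | hT3
  · -- `T ≤ 2`
    obtain ⟨i, hi⟩ := H₂ N Q p ε (by omega) hT hp hε hv
    exact ⟨i, mono (by rw [hC']; exact (min_le_left _ _).trans (min_le_right _ _))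
      (by rw [hc']; exact (le_max_right _ _).trans (le_max_left _ _)) hi⟩
  · -- `T ≥ 3`: middle band or extreme levels
    set W : ℕ → ℝ := fun k =>
      ∑ S ∈ univ.filter (fun S : Finset (Fin N) => S.card = k), cubeFourierCoeff (evalBool p) S ^ 2 with hW
    by_cases hmid : boolVariance p ≤ 2 * ∑ k ∈ Finset.Icc 3 (2 * Q.queries - 2), W k
    · obtain ⟨i, hi⟩ := H N Q p ε hT3 hp hε hv hmid
      exact ⟨i, mono (by rw [hC']; exact (min_le_left _ _).trans (min_le_left _ _))
        (by rw [hc']; exact (le_max_left _ _).trans (le_max_left _ _)) hi⟩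
    · push Not at hmid
      rcases Nat.eq_zero_or_pos N with hN0 | hN
      · exfalso
        subst hN0
        have h0 : boolVariance p = 0 := by
          unfold boolVariance boolAvg
          rw [Fintype.sum_unique, Fintype.sum_unique]
          simp
        linarith
      have hsum : boolVariance p ≤ ∑ k ∈ Finset.Icc 1 (2 * Q.queries), W k :=
        boolVariance_le_sum_levels p fun S hS => cubeFourierCoeff_acceptPoly_eq_zero Q p hp hS
      rw [sum_Icc_levels_split hT3 W] at hsum
      have hWm : 0 ≤ ∑ k ∈ Finset.Icc 3 (2 * Q.queries - 2), W k :=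
        Finset.sum_nonneg fun k _ => Finset.sum_nonneg fun S _ => sq_nonneg _
      have hmass : (1 / 2 : ℝ) * boolVariance p ≤ W 1 + W 2 + (W (2 * Q.queries) + W (2 * Q.queries - 1)) := by
        linarith
      obtain ⟨i, hi⟩ := aaQuery_of_extremeLevels_share hN Q (by omega) p hp (by norm_num : (0 : ℝ) ≤ 1 / 2) hmass
      refine ⟨i, mono (C₀ := 1 / 2304) (c₀ := 6) (by rw [hC']; exact min_le_right _ _)
        (by rw [hc']; exact le_max_right _ _) ?_⟩
      -- `(1/2)² Var² ≤ 576 T⁶ Inf` ⇒ `(1/2304) (ε/T)^6 ≤ Inf` (as `ε ≤ Var ≤ 1`)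
      have hI := influence_nonneg i p
      have hε1 : ε ≤ 1 := hv.trans hv1
      have hε2 : ε ^ 2 ≤ boolVariance p ^ 2 := pow_le_pow_left₀ hε.le hv 2
      have hε6 : ε ^ 6 ≤ ε ^ 2 := by
        have : ε ^ 4 ≤ 1 := pow_le_one₀ hε.le hε1
        nlinarith [pow_pos hε 2]
      have hT6 : (0 : ℝ) < (Q.queries : ℝ) ^ 6 := by positivity
      rw [div_pow, show (1 / 2304 : ℝ) * (ε ^ 6 / (Q.queries : ℝ) ^ 6) = ε ^ 6 / (2304 * (Q.queries : ℝ) ^ 6) by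
        ring, div_le_iff₀ (by positivity)]
      nlinarith [hi, hε2, hε6, hI]

/-- **The converse (restriction): `AA_Q` ⟹ middle-band `AA_Q`.** [cite: AaronsonAmbainis2014, Conj. 6] -/
theorem middleBand_of_aaQuery
    (hAAQ : ∃ (c : ℕ) (C : ℝ), 0 < C ∧ ∀ (N : ℕ) (Q : QQueryAlg N) (p : MvPolynomial (Fin N) ℝ) (ε : ℝ),
      1 ≤ Q.queries → (∀ x, evalBool p x = Q.acceptProb x) → 0 < ε → ε ≤ boolVariance p →
        ∃ i : Fin N, C * (ε / Q.queries) ^ c ≤ influence i p) :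
    ∃ (c : ℕ) (C : ℝ), 0 < C ∧ ∀ (N : ℕ) (Q : QQueryAlg N) (p : MvPolynomial (Fin N) ℝ) (ε : ℝ),
      3 ≤ Q.queries → (∀ x, evalBool p x = Q.acceptProb x) → 0 < ε → ε ≤ boolVariance p →
      boolVariance p ≤ 2 * ∑ k ∈ Finset.Icc 3 (2 * Q.queries - 2),
        ∑ S ∈ univ.filter (fun S : Finset (Fin N) => S.card = k), cubeFourierCoeff (evalBool p) S ^ 2 →
        ∃ i : Fin N, C * (ε / Q.queries) ^ c ≤ influence i p := by
  obtain ⟨c, C, hC, H⟩ := hAAQ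
  exact ⟨c, C, hC, fun N Q p ε hT hp hε hv _ => H N Q p ε (by omega) hp hε hv⟩

/-- **`AA_Q` ⟺ middle-band `AA_Q`.**  The open content of the route's analytic crux is exactly the influence bound
for bounded quantum acceptance polynomials with half their variance on the Fourier levels `3 … 2T-2`, `T ≥ 3`.
[cite: AaronsonAmbainis2014, Conj. 6] [cite: ODonnell2014, §1.4] -/
theorem aaQuery_iff_middleBand :
    (∃ (c : ℕ) (C : ℝ), 0 < C ∧ ∀ (N : ℕ) (Q : QQueryAlg N) (p : MvPolynomial (Fin N) ℝ) (ε : ℝ),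
      1 ≤ Q.queries → (∀ x, evalBool p x = Q.acceptProb x) → 0 < ε → ε ≤ boolVariance p →
        ∃ i : Fin N, C * (ε / Q.queries) ^ c ≤ influence i p) ↔
    (∃ (c : ℕ) (C : ℝ), 0 < C ∧ ∀ (N : ℕ) (Q : QQueryAlg N) (p : MvPolynomial (Fin N) ℝ) (ε : ℝ),
      3 ≤ Q.queries → (∀ x, evalBool p x = Q.acceptProb x) → 0 < ε → ε ≤ boolVariance p →
      boolVariance p ≤ 2 * ∑ k ∈ Finset.Icc 3 (2 * Q.queries - 2),
        ∑ S ∈ univ.filter (fun S : Finset (Fin N) => S.card = k), cubeFourierCoeff (evalBool p) S ^ 2 →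
        ∃ i : Fin N, C * (ε / Q.queries) ^ c ≤ influence i p) :=
  ⟨middleBand_of_aaQuery, aaQuery_of_middleBand⟩

end Summit.QuantumAdvantage.QuantumAdvantage.Theorems.SosSandwich.LevelTwoRung
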